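/- Copyright: the b2b-balaban cell (near-miss cell 7), T⁴-continuum fan-out, ROUND-2 swarm `t4-ne7b-formalise-*`
(leaf 08), row NE7b (node U5c COUNT member).  Released under the licence of the surrounding project. -/
import Summits.QuantumFields.BalabanUV.T4Continuum.Support.HistoryRealiseTimed

/-!
# Realised histories are inhabited, non-vacuously: a renewal and an m2 join on the line (row S1b, sanity companion)

Summits-side support leaf of the T⁴-continuum cell (rung (B)+1 on a FINITE torus only; NOT infinite volume, NOT the
mass gap, NOT the Clay statement; NOT a proof of the spine estimate NE7b).  Companion of row S1b's `HistoryRealise`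
(p209120) ∕ `HistoryRealiseTimed` (p209488): DECIDED TOY DATA in the `d = 1` index model showing that the three clauses
of `Realises` are jointly satisfiable WITH a renewal and WITH a join (not only by a bare birth), and exercising the
main theorems on them.  [folklore] model data; nothing of Bałaban's constructed, nothing printed asserted, no `[cite:]`
tag; toy numerals live only in this file (trigger c6).

THE TOY FLOW.  `L = 4`, exponents `s ≡ 0` (every step coarsens by `4`; drop-controlled by `B16Absorption.dropCtl_const`),
sizes `R ≡ 2` (memory `N = 2`: no component is ready before two clean scales), merger allowance `n₁ = 13`.
* §1 the unit region `{0}` born at step `0` (part 2's `Sanity.unit`): its orbit is `[−10, 10]` at step `1` and lies in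
  `[−13, 13]` at step `2`; it is READY AT `k = 2` (`Stops … 2`) and not before (`N = 2`).
* §2 **a renewal**: `renT = renew unit 2` is realised by the orbit at step `3`; by `exists_stop_lt_reach` it stops strictly
  inside its booked life `3 + (R 3 + 1) = 6`.
* §3 **an m2 join**: a second unit region `{84}` born at `0`; at step `1` the two orbits `[−10,10]` and `[11,31]` TOUCH
  (cubes `10`, `11`), both lines are pending (nothing stops before `N = 2`), so `m2T = join unit far 1` is realised by
  the union of the two orbits; by the main theorem it stops strictly inside its booked life `max 4 4 + (13 + 2) = 19`,
  its flat label is `ConsistentTLE` at the cutoff `1` (part 3), and pending at `1` gives `1 < 19`.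

HONEST.  Toy data; NE7b NOT proved; spine 0∕9.  HONEST DEPENDENCY (cell): continuum YM on T⁴ ⇐ BetaPertH ∧ nine spine
estimates (0/9 proved); BetaPertH ⇐ (D1) ∧ (D4) ∧ CAP+tail.  This file changes none of it. -/

open Finset
open Literature.MathematicalPhysics.QuantumFieldTheory.Balaban1983to89
open Literature.MathematicalPhysics.QuantumFieldTheory.Balaban1983to89.B13ScaleTransfer
open Literature.MathematicalPhysics.QuantumFieldTheory.Balaban1983to89.TreeLength
open Literature.MathematicalPhysics.QuantumFieldTheory.Balaban1983to89.B16SProfile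
open Literature.MathematicalPhysics.QuantumFieldTheory.Balaban1983to89.B16StoppingRule
open Literature.MathematicalPhysics.QuantumFieldTheory.Balaban1983to89.B16MergeGeometry
open Literature.MathematicalPhysics.QuantumFieldTheory.Balaban1983to89.B16MergeGeometry.OneDim
open Literature.MathematicalPhysics.QuantumFieldTheory.Balaban1983to89.B16Absorption
open T4PersistenceDictionary
open Summit.QuantumFields.BalabanUV.T4Continuum.HistoryAdmissible
open Summit.QuantumFields.BalabanUV.T4Continuum.HistoryWindows
open Summit.QuantumFields.BalabanUV.T4Continuum.HistoryBankingLE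

namespace Summit.QuantumFields.BalabanUV.T4Continuum.HistoryRealise.Witness

noncomputable section

/-- toy exponents: every step coarsens by `L` [folklore] -/
def s₀ : ℕ → ℕ := fun _ => 0

/-- toy sizes: memory `2` at every step [folklore] -/
def R₂ : ℕ → ℕ := fun _ => 2

/-- toy constants with the merger allowance `n₁ = 13` (the only field used) [folklore] -/
def Cw : T4PrintedShapeBanking.Consts :=
  { n₁ := 13, dC := 1, q' := 1, E₂ := 1, E₃ := 1, κ₁ := 1, E₀ := 1, Eb := 1, μ := 1, a := 1, A₀ := 1, p₀ := 1 }

/-- the toy flow is drop-controlled on every horizon [folklore] -/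
theorem dropCtl_s₀ (m : ℕ) : DropCtl s₀ m := dropCtl_const 0 m

/-- the toy sizes are `≥ 1` [folklore] -/
theorem one_le_R₂ (t : ℕ) : 1 ≤ R₂ t := by simp [R₂]

/-! ## §1 The unit region: orbit, readiness at `k = 2`, not before -/

/-- the unit region's orbit at step `1` lies in `[−10, 10]`, at step `2` in `[−13, 13]` (decided) [folklore] -/
theorem orbit_unit_boxed :
    orbit 4 s₀ 0 ({pt 0} : Finset (Pt 1)) 1 ⊆ pbox (pt (-10)) (pt 10) ∧
      orbit 4 s₀ 0 ({pt 0} : Finset (Pt 1)) 2 ⊆ pbox (pt (-13)) (pt 13) := by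
  constructor <;> decide

/-- hence condition (i) at steps `1` and `2` [folklore] -/
theorem condI_orbit_unit : CondI 100 (orbit 4 s₀ 0 ({pt 0} : Finset (Pt 1)) 1) ∧
    CondI 100 (orbit 4 s₀ 0 ({pt 0} : Finset (Pt 1)) 2) :=
  ⟨condI_of_boxed ⟨_, _, orbit_unit_boxed.1, fun _ => by simp [pt]⟩,
    condI_of_boxed ⟨_, _, orbit_unit_boxed.2, fun _ => by simp [pt]⟩⟩

/-- **THE UNIT REGION IS READY AT `k = 2`** (conditions (i) at scales `1, 2`, memory `2`, clean steps) [folklore] -/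
theorem stops_unit_two : Stops 4 s₀ R₂ 0 ({pt 0} : Finset (Pt 1)) 2 := by
  refine ⟨by norm_num, condI_orbit_unit.2, by simp [R₂], fun l h1 h2 => ⟨trivial, ?_⟩⟩
  simp only [R₂] at h1
  rcases (show l = 1 ∨ l = 2 by omega) with rfl | rfl
  · exact condI_orbit_unit.1
  · exact condI_orbit_unit.2

/-- … and not before (nothing stops before the memory `N = 2` has elapsed) [folklore] -/
theorem not_stops_unit_lt (k : ℕ) (hk : k < 2) : ¬ Stops 4 s₀ R₂ 0 ({pt 0} : Finset (Pt 1)) k :=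
  fun h => by have := h.le; simp [R₂] at this; omega

/-! ## §2 A renewal, realised -/

/-- the unit region renewed at `3` after its first readiness at `2` [folklore] -/
def renT : PGen (Pt 1 × Finset (Pt 1)) := .renew Sanity.unit 2

/-- **`renT` IS REALISED** by the orbit at step `3` [folklore] -/
theorem realises_renT : Realises 4 s₀ R₂ renT (orbit 4 s₀ 0 {pt 0} 3) :=
  ⟨{pt 0}, Sanity.realises_unit 4 s₀ R₂, stops_unit_two, not_stops_unit_lt, rfl⟩

/-- hence it stops strictly inside its booked life `3 + (R 3 + 1) = 6` [folklore] -/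
theorem renT_stops : ∃ k, 1 ≤ k ∧ Stops 4 s₀ R₂ 3 (orbit 4 s₀ 0 {pt 0} 3) k ∧ 3 + k < 6 := by
  have h := exists_stop_lt_reach (le_refl 4) dropCtl_s₀ one_le_R₂ (n₁ := 13) le_rfl renT _ realises_renT
  simpa [renT, Sanity.unit, PGen.lastStep, PGen.toGen, dictW, R₂] using h

/-! ## §3 An m2 join, realised -/

/-- a second unit region, at index `84` [folklore] -/
def far : PGen (Pt 1 × Finset (Pt 1)) := .birth 0 0 (pt 84, {pt 84})

/-- it is realised by its own region [folklore] -/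
theorem realises_far : Realises 4 s₀ R₂ far {pt 84} :=
  ⟨rfl, mem_singleton_self _,
    fun x hx y hy => by rw [mem_singleton] at hx hy; subst hx; subst hy; exact Relation.ReflTransGen.refl,
    by rw [treeLen_singleton]; norm_num⟩

/-- **THE m2 JOIN** of the two unit regions at step `1` [folklore] -/
def m2T : PGen (Pt 1 × Finset (Pt 1)) := .join Sanity.unit far 1

/-- the joined domain: the union of the two orbits at step `1` (`[−10, 10] ∪ [11, 31]`) [folklore] -/
def Zm2 : Finset (Pt 1) := orbit 4 s₀ 0 {pt 0} 1 ∪ orbit 4 s₀ 0 {pt 84} 1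

/-- at step `1` the orbits TOUCH: the cubes `10` and `11` (decided memberships) [folklore] -/
theorem touch_at_one : pt 10 ∈ orbit 4 s₀ 0 ({pt 0} : Finset (Pt 1)) 1 ∧
    pt 11 ∈ orbit 4 s₀ 0 ({pt 84} : Finset (Pt 1)) 1 ∧ Touch (pt 10 : Pt 1) (pt 11) :=
  ⟨by decide, by decide, fun _ => by simp [pt]⟩

/-- a line born at `0` is pending at `1` (nothing stops before `N = 2`) [folklore] -/
theorem pendingAt_one (Z : Finset (Pt 1)) : PendingAt 4 s₀ R₂ 0 Z 1 :=
  ⟨by norm_num, fun k hk h => by have := h.le; simp [R₂] at this; omega⟩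

/-- **`m2T` IS REALISED** by `Zm2`: both partners pending at `1`, their images touch, domain = the union [folklore] -/
theorem realises_m2T : Realises 4 s₀ R₂ m2T Zm2 :=
  ⟨{pt 0}, {pt 84}, Sanity.realises_unit 4 s₀ R₂, realises_far, by decide, by decide, pendingAt_one _, pendingAt_one _,
    ⟨pt 10, touch_at_one.1, pt 11, touch_at_one.2.1, touch_at_one.2.2⟩, subset_rfl⟩

/-- hence (main theorem) it stops strictly inside its booked life `max 4 4 + (13 + 2) = 19` [folklore] -/
theorem m2T_stops : ∃ k, 1 ≤ k ∧ Stops 4 s₀ R₂ 1 Zm2 k ∧ 1 + k < 19 := by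
  have h := exists_stop_lt_reach (le_refl 4) dropCtl_s₀ one_le_R₂ (n₁ := 13) le_rfl m2T Zm2 realises_m2T
  simpa [m2T, far, Sanity.unit, PGen.lastStep, PGen.toGen, dictW, R₂, fatWait] using h

/-- … its flat label is `ConsistentTLE` at the cutoff `1` (part 3; no timing display) [folklore] -/
theorem m2T_consistentTLE : ConsistentTLE id Cw 1 R₂ m2T.toGen :=
  consistentTLE_toGen_of_realises (le_refl 4) dropCtl_s₀ one_le_R₂ Cw (by simp [Cw]) m2T Zm2 realises_m2T le_rfl

/-- … and, pending at the cutoff `1`, it is inside its booked life [folklore] -/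
theorem m2T_pending_lt_reach : 1 < m2T.toGen.reach (dictW R₂ 13) :=
  lt_reach_of_pendingAt (le_refl 4) dropCtl_s₀ one_le_R₂ (n₁ := 13) le_rfl realises_m2T
    ⟨le_rfl, fun k hk h => by have := h.pos; simp [m2T, PGen.lastStep] at hk; omega⟩

end

end Summit.QuantumFields.BalabanUV.T4Continuum.HistoryRealise.Witness
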